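import Summits.QuantumFields.YangMills.Theorems.BalabanUVNodesN11SpaceTruncationDefs

/-!
# DAG node N11 — DEFINITIONS: THE RADIAL RETRACTION `retractC` AND THE SPACE TRUNCATION WITH BOREL 𝐁-TERMS (`spaceTruncR`) — door (d4), the sixth row

HEADER — WORK-UNIT METADATA.  Cell `pub-ymgap`, YM-PLAN Track A (HUMAN RULING D-0062), seat `pub-ymgap-dag-n11-d` (g11; R134 fan-out seat N11 [B14], strategy s2),
route `BalabanUVNodes`, item K1⁷ `StabilityBAtRecordR13SepCoPH` = stmt-QuantumFields-20542; DEFINITION lane (`--kind definition --supports 20542 --as helper`),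
count-neutral.  [III] = [Balaban1988Convergent].  Over this seat's `…N11OpenLocusTruncationDefs` ∕ `…N11SpaceTruncationDefs` (p589021 ∕ p589408: `truncC`, `thr`, `spaceTrunc`,
law transport) and g10's `…N11FluctTruncationDefs` (`IsFluctLocal`).

WHY THIS FILE.  `spaceTrunc` (p589408) truncates the boundary terms `𝐁^{(j)}(X; φ, ({S_i}, A))` to their analyticity locus SEPARATELY FOR EACH fluctuation datum —
enough for the bound row, useless for JOINT measurability in `(U, A)`: no law of r11's packages constrains the `A`-dependence of `𝐁` (LOCATED-B of record: print
p.260 «analytic functions of the variables (𝐔,𝐉)», (2.41)(i),(iii) — nothing on `A`), so no operation on witnesses can produce it.  What CAN be done: if a witness's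
`𝐁`-terms ARE Borel along the background embedding jointly with the fluctuation datum (true for any explicitly constructed term values — the future terms OF
RECORD), KEEP that and still bound `𝐁` while preserving analyticity in `φ`: the RADIAL RETRACTION `z ↦ (c ∕ max(c, |z|))·z` is continuous, is the identity on
`|z| ≤ c`, has modulus `≤ c`, and — composed with a function analytic at a point where the modulus is `< c` — stays analytic there (by continuity the retraction
is inactive nearby).  `spaceTruncR S n₀ t`: `𝐄 ∕ 𝐑` as in `spaceTrunc` (open-locus truncation), `𝐁` retracted at the threshold of (2.42) (levels `[1, n₀]`, else `0`).

WHAT THIS FILE DECLARES (definitions + bookkeeping, 0 `sorry`).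
* §1 `retractC c` (`continuous_retractC`, `retractC_of_norm_le`, `norm_retractC_le`, `analyticAt_retractC_comp`, `retractC_eventuallyEq_comp`).
* §2 **`spaceTruncR S n₀ t`** (`𝐄 ∕ 𝐑` fields = `spaceTrunc`'s, `rfl`); faces; ★★ `lawsRT_spaceTruncR` (`k ≤ n₀`), ★★ `lawsT_spaceTruncR` (`k + 1 ≤ n₀`), `universalE_spaceTruncR`,
  `isFluctLocal_spaceTruncR`.
* §3 ROWS: `measurable_re_spaceTruncR_E∕R_comp` (= `spaceTrunc`'s), ★ `measurable_re_spaceTruncR_B_comp_of_borel` (JOINT, from joint Borel-ness of the input's `𝐁`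
  along the background map), `exists_bound_spaceTruncR_E∕R∕B`; `measurable_truncMSFluct` and `measurable_B_truncTermValues_of_borel` (joint Borel-ness passes
  through g10's fluctuation truncation).

HONEST FRAMING.  Helper lane of K1⁷; an operation on witnesses + elementary analysis; nothing of Bałaban's is asserted.  N11 NOT discharged; K1⁷ NOT closed; counts
unmoved (typed 28∕28 · discharged 5∕27).  One finite four-torus programme at fixed `ε = L^{−K}` — NOT ℝ⁴, NOT OS, NOT a mass gap, NOT Clay.  No `sorry`, `axiom`,
`instance`, `notation`.  Sources (SHAPE only): [III] (2.40)–(2.42) p.261, p.260, (2.27) p.259, (2.30)–(2.31) p.260, §2 p.262.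
-/

noncomputable section

open MeasureTheory Set Filter Topology
open scoped BigOperators

universe u

namespace Summit.QuantumFields.YangMills.Theorems.BalabanUVNodesN11SpaceTruncationBorelBDefs

open Literature.MathematicalPhysics.QuantumFieldTheory.Balaban1983to89 T4Continuum Node00 Node00.Tk
open Step B14.Eq227LocalizedTerms
open BalabanUVNodesN11FluctTruncationDefs (IsFluctLocal truncMSFluct truncTermValues)
open BalabanUVNodesN11OpenLocusTruncationDefs BalabanUVNodesN11SpaceTruncationDefs

/-! ## §1  The radial retraction of `ℂ` onto the closed disc of radius `c` -/

section Retract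

/-- **THE RADIAL RETRACTION** `z ↦ (c ∕ max(c, |z|))·z`: the identity on `|z| ≤ c`, radial projection onto the circle `|z| = c` beyond.
[cite: Balaban1988Convergent, (2.42) p.261 (bookkeeping shape)] -/
def retractC (c : ℝ) (z : ℂ) : ℂ :=
  ((c / max c ‖z‖ : ℝ) : ℂ) * z

/-- The retraction is continuous (for `0 < c`: the denominator `max(c, |z|) ≥ c > 0`). [cite: Balaban1988Convergent, (2.42) p.261 (bookkeeping)] -/
theorem continuous_retractC {c : ℝ} (hc : 0 < c) : Continuous (retractC c) := by
  unfold retractC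
  refine Continuous.mul (Complex.continuous_ofReal.comp ?_) continuous_id
  exact continuous_const.div (continuous_const.max continuous_norm) fun z => (lt_of_lt_of_le hc (le_max_left c ‖z‖)).ne'

/-- On the disc the retraction is the identity. [cite: Balaban1988Convergent, (2.42) p.261 (bookkeeping)] -/
theorem retractC_of_norm_le {c : ℝ} (hc : 0 < c) {z : ℂ} (h : ‖z‖ ≤ c) : retractC c z = z := by
  unfold retractC
  rw [max_eq_left h, div_self hc.ne', Complex.ofReal_one, one_mul]

/-- The retraction has modulus at most `c`. [cite: Balaban1988Convergent, (2.42) p.261 (bookkeeping)] -/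
theorem norm_retractC_le {c : ℝ} (hc : 0 < c) (z : ℂ) : ‖retractC c z‖ ≤ c := by
  unfold retractC
  have hm : 0 < max c ‖z‖ := lt_of_lt_of_le hc (le_max_left c ‖z‖)
  rw [norm_mul, Complex.norm_real, Real.norm_eq_abs, abs_of_nonneg (div_nonneg hc.le hm.le), div_mul_eq_mul_div, div_le_iff₀ hm]
  exact mul_le_mul_of_nonneg_left (le_max_right c ‖z‖) hc.le

/-- The real part of the retraction is at most `c` in absolute value. [cite: Balaban1988Convergent, (2.42) p.261 (bookkeeping)] -/
theorem abs_re_retractC_le {c : ℝ} (hc : 0 < c) (z : ℂ) : |(retractC c z).re| ≤ c :=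
  (Complex.abs_re_le_norm _).trans (norm_retractC_le hc z)

/-- Composed with a function continuous at a point of modulus `< c`, the retraction is INACTIVE NEAR that point. [cite: Balaban1988Convergent, (2.41)(ii) p.261 (bookkeeping)] -/
theorem retractC_eventuallyEq_comp {Φ : Type*} [TopologicalSpace Φ] {c : ℝ} (hc : 0 < c) {f : Φ → ℂ} {φ : Φ} (hf : ContinuousAt f φ) (h : ‖f φ‖ < c) :
    (fun ψ => retractC c (f ψ)) =ᶠ[𝓝 φ] f := by
  have hev : ∀ᶠ ψ in 𝓝 φ, ‖f ψ‖ < c := (continuous_norm.continuousAt.comp hf).eventually (gt_mem_nhds h)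
  exact hev.mono fun ψ hψ => retractC_of_norm_le hc hψ.le

/-- **THE RETRACTION KEEPS ANALYTICITY** at every point where the function is analytic with modulus `< c`. [cite: Balaban1988Convergent, (2.41)(ii) p.261 (bookkeeping)] -/
theorem analyticAt_retractC_comp {Φ : Type*} [NormedAddCommGroup Φ] [NormedSpace ℂ Φ] {c : ℝ} (hc : 0 < c) {f : Φ → ℂ} {φ : Φ} (hf : AnalyticAt ℂ f φ) (h : ‖f φ‖ < c) :
    AnalyticAt ℂ (fun ψ => retractC c (f ψ)) φ :=
  hf.congr (retractC_eventuallyEq_comp hc hf.continuousAt h).symm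

end Retract

/-! ## §2  The space truncation with retracted boundary terms -/

section Trunc

variable {P : Params} {𝔸 : Type*} [NormedRing 𝔸] [NormedAlgebra ℂ 𝔸] {V : Type u} {M : ℕ} {G : Type*} [GaugeGroup G]

/-- **THE SPACE TRUNCATION WITH BOREL 𝐁-TERMS** `spaceTruncR S n₀ t`: `𝐄`, `𝐑` as in `spaceTrunc` (open-locus truncation); `𝐁^{(j)}(X; ·, a)` RETRACTED radially at the
threshold of its (2.42) bound on the levels `1 ≤ j ≤ n₀`, zero elsewhere — no locus indicator, so joint Borel-ness in `(φ, a)` of the input is kept.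
[cite: Balaban1988Convergent, (2.27) p.259, (2.30)–(2.31) p.260, (2.40)–(2.42) p.261] -/
def spaceTruncR (S : Sect2.Setting 𝔸 G) (n₀ : ℕ) (t : Sect2.TermValues P 𝔸 V M) : Sect2.TermValues P 𝔸 V M where
  E := (spaceTrunc S n₀ t).E
  R := (spaceTrunc S n₀ t).R
  B := fun j X φ a => if 1 ≤ j ∧ j ≤ n₀ then retractC (thr S.lf S.βc S.lf.B₀ ((Sect2.domSys P M j).dj X)) (t.B j X φ a) else 0

variable (S : Sect2.Setting 𝔸 G) (n₀ : ℕ) (t : Sect2.TermValues P 𝔸 V M)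

/-- The `𝐄`-terms are `spaceTrunc`'s (`rfl`). [cite: Balaban1988Convergent, (2.27) p.259 (bookkeeping)] -/
@[simp] theorem spaceTruncR_E : (spaceTruncR S n₀ t).E = (spaceTrunc S n₀ t).E := rfl

/-- The `𝐑`-terms are `spaceTrunc`'s (`rfl`). [cite: Balaban1988Convergent, (2.30) p.260 (bookkeeping)] -/
@[simp] theorem spaceTruncR_R : (spaceTruncR S n₀ t).R = (spaceTrunc S n₀ t).R := rfl

/-- The thresholds are positive. [cite: Balaban1988Convergent, (2.42) p.261 (bookkeeping)] -/
theorem thr_pos (c : LFConsts) (βc b d : ℝ) : 0 < thr c βc b d := by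
  unfold thr; linarith [le_max_right (max (b * Real.exp (-c.κ * d)) (b * Real.exp (-((1 + 4 * βc) * c.κ) * d))) 0]

/-- The `𝐁`-terms in the window, unfolded. [cite: Balaban1988Convergent, (2.40)–(2.41) p.261 (bookkeeping)] -/
theorem spaceTruncR_B_of {j : ℕ} (hj : 1 ≤ j ∧ j ≤ n₀) (X : (Sect2.domSys P M j).Dom) (φ : Sect2.CPair P 𝔸) (a : SFluct P V) :
    (spaceTruncR S n₀ t).B j X φ a = retractC (thr S.lf S.βc S.lf.B₀ ((Sect2.domSys P M j).dj X)) (t.B j X φ a) := if_pos hj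

/-- The `𝐁`-terms off the window vanish. [cite: Balaban1988Convergent, (2.40)–(2.41) p.261 (bookkeeping)] -/
theorem spaceTruncR_B_of_not {j : ℕ} (hj : ¬ (1 ≤ j ∧ j ≤ n₀)) (X : (Sect2.domSys P M j).Dom) (φ : Sect2.CPair P 𝔸) (a : SFluct P V) :
    (spaceTruncR S n₀ t).B j X φ a = 0 := if_neg hj

/-- **BELOW ITS BOUND A RETRACTED 𝐁-TERM IS THE 𝐁-TERM** (no analyticity needed). [cite: Balaban1988Convergent, (2.42) p.261] -/
theorem spaceTruncR_B_eq_of_le {j : ℕ} (hj : 1 ≤ j ∧ j ≤ n₀) (X : (Sect2.domSys P M j).Dom) {φ : Sect2.CPair P 𝔸} (a : SFluct P V)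
    (hb : ‖t.B j X φ a‖ ≤ thr S.lf S.βc S.lf.B₀ ((Sect2.domSys P M j).dj X)) : (spaceTruncR S n₀ t).B j X φ a = t.B j X φ a := by
  rw [spaceTruncR_B_of S n₀ t hj]; exact retractC_of_norm_le (thr_pos _ _ _ _) hb

/-- `‖𝐁‖` of the retracted family is bounded by the threshold. [cite: Balaban1988Convergent, (2.42) p.261 (bookkeeping)] -/
theorem norm_spaceTruncR_B_le (j : ℕ) (X : (Sect2.domSys P M j).Dom) (φ : Sect2.CPair P 𝔸) (a : SFluct P V) :
    ‖(spaceTruncR S n₀ t).B j X φ a‖ ≤ thr S.lf S.βc S.lf.B₀ ((Sect2.domSys P M j).dj X) := by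
  by_cases hj : 1 ≤ j ∧ j ≤ n₀
  · rw [spaceTruncR_B_of S n₀ t hj]; exact norm_retractC_le (thr_pos _ _ _ _) _
  · rw [spaceTruncR_B_of_not S n₀ t hj, norm_zero]; exact thr_nonneg _ _ _ _

end Trunc

/-! ## §3  Transport of r11's law packages -/

section Laws

variable {P : Params} {𝔸 : Type*} [NormedRing 𝔸] [NormedAlgebra ℂ 𝔸] [CompleteSpace 𝔸] {V : Type u} {M : ℕ} {G : Type*} [GaugeGroup G]
variable (S : Sect2.Setting 𝔸 G) (Rz : Sect2.Residual P 𝔸) (Ω : ℕ → Set (Site P 0)) (t : Sect2.TermValues P 𝔸 V M)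

/-- **r11's INDUCTIVE BOUNDS TRANSPORT** (index `k ≤ n₀`; the `𝐄 ∕ 𝐑` clauses are `spaceTrunc`'s, the `𝐁` bound by retraction below its (2.42) bound).
[cite: Balaban1988Convergent, (2.27)(i)–(iv) p.259, (2.31) p.260, (2.42) p.261] -/
theorem lfHyp_spaceTruncR {k n₀ : ℕ} (hk : k ≤ n₀) (h : LFHyp (Sect2.towerOfTerms S Rz M Ω t) S.lf k)
    (ha : LFHypAnalytic (Sect2.towerOfTerms S Rz M Ω t) S.lf k) : LFHyp (Sect2.towerOfTerms S Rz M Ω (spaceTruncR S n₀ t)) S.lf k where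
  rg := h.rg
  localDepE := (lfHyp_spaceTrunc S Rz Ω t hk h ha).localDepE
  localDepR := (lfHyp_spaceTrunc S Rz Ω t hk h ha).localDepR
  boundE := (lfHyp_spaceTrunc S Rz Ω t hk h ha).boundE
  boundR := (lfHyp_spaceTrunc S Rz Ω t hk h ha).boundR
  boundB := fun j h1 hj X φ a hφ => by
    show ‖(spaceTruncR S n₀ t).B j X φ a‖ ≤ _
    rw [spaceTruncR_B_eq_of_le S n₀ t ⟨h1, hj.trans hk⟩ X a ((h.boundB j h1 hj X φ a hφ).trans (lt_thr_left _ _ _ _).le)]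
    exact h.boundB j h1 hj X φ a hφ
  gaugeInvE := (lfHyp_spaceTrunc S Rz Ω t hk h ha).gaugeInvE
  gaugeInvR := (lfHyp_spaceTrunc S Rz Ω t hk h ha).gaugeInvR

/-- **THE ANALYTICITY CLAUSE TRANSPORTS** (index `k ≤ n₀`), GIVEN strict sub-threshold bounds on the spaces; for `𝐁` by `analyticAt_retractC_comp`.
[cite: Balaban1988Convergent, (2.27)(ii) p.259, (2.30) p.260, (2.41)(ii) p.261] -/
theorem lfHypAnalytic_spaceTruncR_of_lt {k n₀ : ℕ} (hk : k ≤ n₀) (ha : LFHypAnalytic (Sect2.towerOfTerms S Rz M Ω t) S.lf k)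
    (hbE : ∀ j, 1 ≤ j → j ≤ k → ∀ (X : (Sect2.domSys P M j).Dom) (z : Site P j) (g : ℝ) (φ : Sect2.CPair P 𝔸), 0 ≤ g → g ≤ S.lf.γ →
      φ ∈ Sect2.spaceI S Rz M j (Sect2.domSites P M j X) (S.lf.alpha0 (S.flow.g j)) (S.lf.alpha1 (S.flow.g j)) →
        ‖t.E j X z g φ‖ < thr S.lf S.βc S.lf.E₀ ((Sect2.domSys P M j).dj X))
    (hbR : ∀ j, 1 ≤ j → j ≤ k → ∀ (X : (Sect2.domSys P M j).Dom) (φ : Sect2.CPair P 𝔸),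
      φ ∈ Sect2.spaceI S Rz M j (Sect2.domSites P M j X) (S.lf.alpha0 (S.flow.g j)) (S.lf.alpha1 (S.flow.g j)) →
        ‖t.R j X φ‖ < thr S.lf S.βc (S.flow.g j ^ S.lf.κ₀) ((Sect2.domSys P M j).dj X))
    (hbB : ∀ j, 1 ≤ j → j ≤ k → ∀ (X : (Sect2.domSys P M j).Dom) (φ : Sect2.CPair P 𝔸) (a : SFluct P V),
      φ ∈ Sect2.spaceMS S Rz M j (Sect2.domSites P M j X) Ω → ‖t.B j X φ a‖ < thr S.lf S.βc S.lf.B₀ ((Sect2.domSys P M j).dj X)) :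
    LFHypAnalytic (Sect2.towerOfTerms S Rz M Ω (spaceTruncR S n₀ t)) S.lf k where
  analyticE := (lfHypAnalytic_spaceTrunc_of_lt S Rz Ω t hk ha hbE hbR hbB).analyticE
  analyticR := (lfHypAnalytic_spaceTrunc_of_lt S Rz Ω t hk ha hbE hbR hbB).analyticR
  analyticB := fun j h1 hj X a => by
    show AnalyticOnNhd ℂ (fun φ => (spaceTruncR S n₀ t).B j X φ a) _
    simp only [spaceTruncR_B_of S n₀ t ⟨h1, hj.trans hk⟩]
    exact fun φ hφ => analyticAt_retractC_comp (thr_pos _ _ _ _) (ha.analyticB j h1 hj X a φ hφ) (hbB j h1 hj X φ a hφ)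

/-- The analyticity clause transports at index `k ≤ n₀` given the inductive bounds at the same index. [cite: Balaban1988Convergent, (2.27)(ii),(iv) p.259, (2.41)(ii), (2.42) p.261] -/
theorem lfHypAnalytic_spaceTruncR {k n₀ : ℕ} (hk : k ≤ n₀) (h : LFHyp (Sect2.towerOfTerms S Rz M Ω t) S.lf k)
    (ha : LFHypAnalytic (Sect2.towerOfTerms S Rz M Ω t) S.lf k) : LFHypAnalytic (Sect2.towerOfTerms S Rz M Ω (spaceTruncR S n₀ t)) S.lf k :=
  lfHypAnalytic_spaceTruncR_of_lt S Rz Ω t hk ha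
    (fun j h1 hj X z g φ hg0 hgγ hφ => lt_of_le_of_lt (h.boundE j h1 hj X z g φ hg0 hgγ hφ) (lt_thr_left _ _ _ _))
    (fun j h1 hj X φ hφ => lt_of_le_of_lt (h.boundR j h1 hj X φ hφ) (lt_thr_left _ _ _ _))
    (fun j h1 hj X φ a hφ => lt_of_le_of_lt (h.boundB j h1 hj X φ a hφ) (lt_thr_left _ _ _ _))

/-- **11c's `LawsRT` TRANSPORTS** at every index `k ≤ n₀`. [cite: Balaban1988Convergent, (2.27)–(2.31) pp.259–260, (2.41)–(2.42) p.261] -/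
theorem lawsRT_spaceTruncR {k n₀ : ℕ} (hk : k ≤ n₀) (h : Sect2.LawsRT (Sect2.towerOfTerms S Rz M Ω t) S.lf k) :
    Sect2.LawsRT (Sect2.towerOfTerms S Rz M Ω (spaceTruncR S n₀ t)) S.lf k :=
  ⟨lfHyp_spaceTruncR S Rz Ω t hk h.1 h.2, lfHypAnalytic_spaceTruncR S Rz Ω t hk h.1 h.2⟩

/-- **THE IMPROVED BOUNDS TRANSPORT** (index `k ≤ n₀`). [cite: Balaban1988Convergent, §2 p.262] -/
theorem lfHypImproved_spaceTruncR {k n₀ : ℕ} (hk : k ≤ n₀) (h : LFHypImproved (Sect2.towerOfTerms S Rz M Ω t) S.lf S.βc k)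
    (ha : LFHypAnalytic (Sect2.towerOfTerms S Rz M Ω t) S.lf k) : LFHypImproved (Sect2.towerOfTerms S Rz M Ω (spaceTruncR S n₀ t)) S.lf S.βc k where
  boundE := (lfHypImproved_spaceTrunc S Rz Ω t hk h ha).boundE
  boundR := (lfHypImproved_spaceTrunc S Rz Ω t hk h ha).boundR
  boundB := fun h1 X φ a hφ => by
    show ‖(spaceTruncR S n₀ t).B k X φ a‖ ≤ _
    rw [spaceTruncR_B_eq_of_le S n₀ t ⟨h1, hk⟩ X a ((h.boundB h1 X φ a hφ).trans (lt_thr_right _ _ _ _).le)]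
    exact h.boundB h1 X φ a hφ

/-- **THE NEW-TERM OBLIGATIONS TRANSPORT** (index `k + 1 ≤ n₀`). [cite: Balaban1988Convergent, §2 p.262] -/
theorem lfNewTerms_spaceTruncR {k n₀ : ℕ} (hk : k + 1 ≤ n₀) (h : LFNewTerms (Sect2.towerOfTerms S Rz M Ω t) S.lf S.βc k)
    (ha : LFHypAnalytic (Sect2.towerOfTerms S Rz M Ω t) S.lf (k + 1)) : LFNewTerms (Sect2.towerOfTerms S Rz M Ω (spaceTruncR S n₀ t)) S.lf S.βc k where
  rg := h.rg
  localDepE := (lfNewTerms_spaceTrunc S Rz Ω t hk h ha).localDepE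
  localDepR := (lfNewTerms_spaceTrunc S Rz Ω t hk h ha).localDepR
  gaugeInvE := (lfNewTerms_spaceTrunc S Rz Ω t hk h ha).gaugeInvE
  gaugeInvR := (lfNewTerms_spaceTrunc S Rz Ω t hk h ha).gaugeInvR
  improved := lfHypImproved_spaceTruncR S Rz Ω t hk h.improved ha

/-- **11c's `LawsT` TRANSPORTS** at every index with `k + 1 ≤ n₀`. [cite: Balaban1988Convergent, §2 p.262, §3 p.279] -/
theorem lawsT_spaceTruncR {k n₀ : ℕ} (hk : k + 1 ≤ n₀) (h : Sect2.LawsT (Sect2.towerOfTerms S Rz M Ω t) S.lf S.βc k) :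
    Sect2.LawsT (Sect2.towerOfTerms S Rz M Ω (spaceTruncR S n₀ t)) S.lf S.βc k := by
  obtain ⟨hH, hN, hA⟩ := h
  refine ⟨lfHyp_spaceTruncR S Rz Ω t (Nat.le_of_succ_le hk) hH (hA.mono (Nat.le_succ k)), lfNewTerms_spaceTruncR S Rz Ω t hk hN hA,
    lfHypAnalytic_spaceTruncR_of_lt S Rz Ω t hk hA ?_ ?_ ?_⟩
  · intro j h1 hj X z g φ hg0 hgγ hφ
    rcases Nat.lt_succ_iff_lt_or_eq.mp (Nat.lt_succ_of_le hj) with hjk | rfl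
    · exact lt_of_le_of_lt (hH.boundE j h1 (Nat.lt_succ_iff.mp hjk) X z g φ hg0 hgγ hφ) (lt_thr_left _ _ _ _)
    · exact lt_of_le_of_lt (hN.improved.boundE h1 X z g φ hg0 hgγ hφ) (lt_thr_right _ _ _ _)
  · intro j h1 hj X φ hφ
    rcases Nat.lt_succ_iff_lt_or_eq.mp (Nat.lt_succ_of_le hj) with hjk | rfl
    · exact lt_of_le_of_lt (hH.boundR j h1 (Nat.lt_succ_iff.mp hjk) X φ hφ) (lt_thr_left _ _ _ _)
    · exact lt_of_le_of_lt (hN.improved.boundR h1 X φ hφ) (lt_thr_right _ _ _ _)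
  · intro j h1 hj X φ a hφ
    rcases Nat.lt_succ_iff_lt_or_eq.mp (Nat.lt_succ_of_le hj) with hjk | rfl
    · exact lt_of_le_of_lt (hH.boundB j h1 (Nat.lt_succ_iff.mp hjk) X φ a hφ) (lt_thr_left _ _ _ _)
    · exact lt_of_le_of_lt (hN.improved.boundB h1 X φ a hφ) (lt_thr_right _ _ _ _)

omit [CompleteSpace 𝔸] in
/-- **UNIVERSALITY OF THE 𝐄-TERMS TRANSPORTS** (the `𝐄`-terms are `spaceTrunc`'s). [cite: Balaban1988Convergent, (2.25)–(2.27) p.259 (bookkeeping)] -/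
theorem universalE_spaceTruncR {ι : Type*} {t : ι → Sect2.TermValues P 𝔸 V M} (h : Sect2.UniversalE t) (S : Sect2.Setting 𝔸 G) (n₀ : ℕ) :
    Sect2.UniversalE (fun i => spaceTruncR S n₀ (t i)) :=
  fun i i' => universalE_spaceTrunc h S n₀ i i'

omit [CompleteSpace 𝔸] in
/-- **`k`-LOCALITY IN THE FLUCTUATION VARIABLES TRANSPORTS** (the retraction acts on the value). [cite: Balaban1988Convergent, (2.40)–(2.41) p.261 (bookkeeping)] -/
theorem isFluctLocal_spaceTruncR {k : ℕ} {t : Sect2.TermValues P 𝔸 V M} (h : IsFluctLocal k t) (S : Sect2.Setting 𝔸 G) (n₀ : ℕ) :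
    IsFluctLocal k (spaceTruncR S n₀ t) := by
  refine ⟨fun j X u S' a a' ha => ?_⟩
  by_cases hj : 1 ≤ j ∧ j ≤ n₀
  · rw [spaceTruncR_B_of S n₀ t hj, spaceTruncR_B_of S n₀ t hj, h.B_congr j X u S' a a' ha]
  · rw [spaceTruncR_B_of_not S n₀ t hj, spaceTruncR_B_of_not S n₀ t hj]

end Laws

/-! ## §4  The rows: Borel along a continuous background map (the 𝐁-terms JOINTLY, from joint Borel-ness of the input), uniform bounds -/

section Rows

variable {P : Params} {𝔸 : Type*} [NormedRing 𝔸] [NormedAlgebra ℂ 𝔸] {V : Type u} {M : ℕ} {G : Type*} [GaugeGroup G]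
variable (S : Sect2.Setting 𝔸 G) (n₀ : ℕ) (t : Sect2.TermValues P 𝔸 V M)

/-- **★ THE RETRACTED 𝐁-TERMS ARE JOINTLY BOREL** along a continuous background map, GIVEN that the input's are (the retraction is continuous).
[cite: Balaban1988Convergent, (2.41) p.261 (bookkeeping)] -/
theorem measurable_re_spaceTruncR_B_comp_of_borel {X' : Type*} [TopologicalSpace X'] [MeasurableSpace X'] [OpensMeasurableSpace X'] {A : Type*} [MeasurableSpace A]
    {bg : X' → Sect2.CPair P 𝔸} (j : ℕ) (X : (Sect2.domSys P M j).Dom) {fl : A → SFluct P V}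
    (hB : Measurable (fun q : X' × A => t.B j X (bg q.1) (fl q.2))) : Measurable (fun q : X' × A => ((spaceTruncR S n₀ t).B j X (bg q.1) (fl q.2)).re) := by
  by_cases hj : 1 ≤ j ∧ j ≤ n₀
  · simp only [spaceTruncR_B_of S n₀ t hj]
    exact Complex.measurable_re.comp ((continuous_retractC (thr_pos _ _ _ _)).measurable.comp hB)
  · simp only [spaceTruncR_B_of_not S n₀ t hj, Complex.zero_re]; exact measurable_const

/-- **A UNIFORM BOUND FOR THE RETRACTED 𝐁-TERMS**. [cite: Balaban1988Convergent, (2.42) p.261 (bookkeeping)] -/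
theorem exists_bound_spaceTruncR_B : ∃ C : ℝ, ∀ (j : ℕ) (X : (Sect2.domSys P M j).Dom) (φ : Sect2.CPair P 𝔸) (a : SFluct P V),
    |((spaceTruncR S n₀ t).B j X φ a).re| ≤ C := by
  refine ⟨∑ j ∈ Finset.range (n₀ + 1), ∑ X : (Sect2.domSys P M j).Dom, thr S.lf S.βc S.lf.B₀ ((Sect2.domSys P M j).dj X), fun j X φ a => ?_⟩
  have hnn : ∀ i ∈ Finset.range (n₀ + 1), 0 ≤ ∑ X : (Sect2.domSys P M i).Dom, thr S.lf S.βc S.lf.B₀ ((Sect2.domSys P M i).dj X) :=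
    fun i _ => Finset.sum_nonneg fun X _ => thr_nonneg _ _ _ _
  by_cases hj : 1 ≤ j ∧ j ≤ n₀
  · calc |((spaceTruncR S n₀ t).B j X φ a).re| ≤ ‖(spaceTruncR S n₀ t).B j X φ a‖ := Complex.abs_re_le_norm _
      _ ≤ thr S.lf S.βc S.lf.B₀ ((Sect2.domSys P M j).dj X) := norm_spaceTruncR_B_le S n₀ t j X φ a
      _ ≤ ∑ X' : (Sect2.domSys P M j).Dom, thr S.lf S.βc S.lf.B₀ ((Sect2.domSys P M j).dj X') :=
          Finset.single_le_sum (f := fun X' => thr S.lf S.βc S.lf.B₀ ((Sect2.domSys P M j).dj X')) (fun X' _ => thr_nonneg _ _ _ _) (Finset.mem_univ X)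
      _ ≤ ∑ i ∈ Finset.range (n₀ + 1), ∑ X' : (Sect2.domSys P M i).Dom, thr S.lf S.βc S.lf.B₀ ((Sect2.domSys P M i).dj X') :=
          Finset.single_le_sum (f := fun i => ∑ X' : (Sect2.domSys P M i).Dom, thr S.lf S.βc S.lf.B₀ ((Sect2.domSys P M i).dj X')) hnn
            (Finset.mem_range.mpr (Nat.lt_succ_of_le hj.2))
  · rw [spaceTruncR_B_of_not S n₀ t hj, Complex.zero_re, abs_zero]
    exact Finset.sum_nonneg hnn

variable [Zero V] [MeasurableSpace V]

omit [NormedRing 𝔸] [NormedAlgebra ℂ 𝔸] [GaugeGroup G] in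
/-- g10's truncation of the all-scale fluctuation datum above `k` is a measurable map. [cite: Balaban1988Convergent, (2.21) p.258 (bookkeeping)] -/
theorem measurable_truncMSFluct (k : ℕ) : Measurable (truncMSFluct (P := P) (V := V) k) := by
  refine measurable_pi_lambda _ fun i => ?_
  by_cases hi : i ≤ k
  · simp only [BalabanUVNodesN11FluctTruncationDefs.truncMSFluct_of_le k _ hi]; exact measurable_pi_apply i
  · simp only [BalabanUVNodesN11FluctTruncationDefs.truncMSFluct_of_lt k _ (Nat.lt_of_not_le hi)]; exact measurable_const

omit [NormedRing 𝔸] [NormedAlgebra ℂ 𝔸] [GaugeGroup G] in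
/-- **JOINT BOREL-NESS OF THE 𝐁-TERMS PASSES THROUGH g10's FLUCTUATION TRUNCATION** `truncTermValues k`. [cite: Balaban1988Convergent, (2.40)–(2.41) p.261 (bookkeeping)] -/
theorem measurable_B_truncTermValues_of_borel {X' : Type*} [MeasurableSpace X'] {bg : X' → Sect2.CPair P 𝔸} (k j : ℕ) (X : (Sect2.domSys P M j).Dom)
    (S' : ℕ → Set (Site P 0)) (hB : Measurable (fun q : X' × MSFluct P V => t.B j X (bg q.1) (S', q.2))) :
    Measurable (fun q : X' × MSFluct P V => (truncTermValues k t).B j X (bg q.1) (S', q.2)) := by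
  simp only [BalabanUVNodesN11FluctTruncationDefs.truncTermValues_B]
  exact hB.comp (measurable_fst.prodMk ((measurable_truncMSFluct (P := P) (V := V) k).comp measurable_snd))

end Rows

end Summit.QuantumFields.YangMills.Theorems.BalabanUVNodesN11SpaceTruncationBorelBDefs

end
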